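import Literature.ModelTheory.ExponentialFields.Wilkie1989
import Literature.ModelTheory.ExponentialFields.RealExpTransfer
import Mathlib.Algebra.MvPolynomial.CommRing
import HarnessLib

/-!
# Exponential subterms of `L_exp`-terms and the elimination of one exponential

Topic `Literature/ModelTheory/ExponentialFields`. Syntactic infrastructure for Khovanskii's
induction over the number of exponentials occurring in a system of terms of the language
`L = (+, ·, -, 0, 1, exp, ≤)` of ordered exponential rings (A. G. Khovanskii, *Fewnomials* (1991),
Ch. I–III: a system `F(x, e^{s₁}, …, e^{s_k}) = 0` is treated by replacing the outermost
exponential `e^{s_k}` by a new variable `y` and adjoining the equation `y = e^{s_k}`; A. J. Wilkie,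
Illinois J. Math. 33 (1989), §5, applies Khovanskii's theorem to `L`-terms). Everything here is
**proved** (definitions by structural recursion on terms):

* `ExpTerm.expSub t` — the finite set of **exponential subterms** `exp(s)` of `t`;
  `ExpTerm.tsize t` — the size of `t`; an exponential subterm of maximal size is not a subterm of
  any other exponential subterm (`tsize_lt_of_mem_expSub_arg`);
* `ExpTerm.substExp e y ι t` — **replace every occurrence of the subterm `e` by the term `y`**,
  relabelling the remaining variables along `ι` (`realize_substExp`: the value is unchanged when
  `y` is given the value of `e`; `substExp_eq_relabel_of_not_mem`: terms not containing `e` are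
  just relabelled; `expSub_substExp_subset`: for `e` of maximal size the exponential subterms of the
  result are relabellings of those of `t` other than `e`, so their number drops);
* `ExpTerm.expSub_termPDeriv_subset` — formal partial derivatives create no new exponentials, and
  the behaviour of `expSub` under `+, ·, -`, finite sums, determinants and relabelling;
* `ExpTerm.toPoly t` and `ExpTerm.realize_eq_aeval_toPoly` — a term **without exponential
  subterms is a polynomial** with integer coefficients in its variables (its realization in `ℝ` is
  the evaluation of `toPoly t`).

## References

* A. G. Khovanskii, *Fewnomials*, Transl. Math. Monogr. 88, AMS (1991), Ch. III. [Khovanskii1991]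
* A. J. Wilkie, *On the theory of the real exponential field*, Illinois J. Math. 33 (1989), §1
  (terms and their formal derivatives, p. 385), §5 (p. 402). [Wilkie1989]
-/

noncomputable section

open FirstOrder FirstOrder.Language FirstOrder.Language.Structure

namespace Literature.ModelTheory.ExponentialFields

/-- The function symbols of `Language.orderedExpRing` in each arity have decidable equality
(they are the constructors of `expRingFunc`). [folklore] -/
instance Language.orderedExpRing.instDecidableEqFunctions (n : ℕ) :
    DecidableEq (Language.orderedExpRing.Functions n) :=
  inferInstanceAs (DecidableEq (expRingFunc n))

namespace ExpTerm

variable {α β γ : Type}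

/-! ### Exponential subterms and size -/

section ExpSub

variable [DecidableEq α]

/-- The finite set of **exponential subterms** of a term: all subterms of the form `exp(s)`.
[folklore] -/
def expSub : Language.orderedExpRing.Term α → Finset (Language.orderedExpRing.Term α)
  | var _ => ∅
  | func expRingFunc.add ts => Finset.univ.biUnion fun i => expSub (ts i)
  | func expRingFunc.mul ts => Finset.univ.biUnion fun i => expSub (ts i)
  | func expRingFunc.neg ts => Finset.univ.biUnion fun i => expSub (ts i)
  | func expRingFunc.zero ts => Finset.univ.biUnion fun i => expSub (ts i)
  | func expRingFunc.one ts => Finset.univ.biUnion fun i => expSub (ts i)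
  | func expRingFunc.exp ts =>
      insert (func expRingFunc.exp ts) (Finset.univ.biUnion fun i => expSub (ts i))

/-- Variables have no exponential subterms. [folklore] -/
@[simp] theorem expSub_var (a : α) : expSub (var a : Language.orderedExpRing.Term α) = ∅ := rfl

/-- The exponential subterms of `exp(ts 0)`: itself and those of its argument. [folklore] -/
theorem expSub_func_exp (ts : Fin 1 → Language.orderedExpRing.Term α) :
    expSub (func expRingFunc.exp ts) =
      insert (func expRingFunc.exp ts) (Finset.univ.biUnion fun i => expSub (ts i)) := by
  rw [expSub]

/-- For a symbol other than `exp`, the exponential subterms are those of the arguments.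
[folklore] -/
theorem expSub_func_of_ne_exp {n : ℕ} (f : Language.orderedExpRing.Functions n)
    (hf : ∀ h : n = 1, h ▸ f ≠ expRingFunc.exp) (ts : Fin n → Language.orderedExpRing.Term α) :
    expSub (func f ts) = Finset.univ.biUnion fun i => expSub (ts i) := by
  cases f with
  | add => rfl
  | mul => rfl
  | neg => rfl
  | zero => rfl
  | one => rfl
  | exp => exact (hf rfl rfl).elim

/-- The exponential subterms of the arguments are exponential subterms of the term. [folklore] -/
theorem expSub_arg_subset {n : ℕ} (f : Language.orderedExpRing.Functions n)
    (ts : Fin n → Language.orderedExpRing.Term α) (i : Fin n) :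
    expSub (ts i) ⊆ expSub (func f ts) := by
  cases f with
  | exp =>
    rw [expSub_func_exp]
    exact (Finset.subset_biUnion_of_mem (fun i => expSub (ts i)) (Finset.mem_univ i)).trans
      (Finset.subset_insert _ _)
  | _ =>
    rw [expSub]
    exact Finset.subset_biUnion_of_mem (fun i => expSub (ts i)) (Finset.mem_univ i)

/-- Every exponential subterm is an `exp`-term. [folklore] -/
theorem exists_eq_exp_of_mem_expSub {t e : Language.orderedExpRing.Term α} (he : e ∈ expSub t) :
    ∃ es : Fin 1 → Language.orderedExpRing.Term α, e = func expRingFunc.exp es := by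
  induction t with
  | var a => simp at he
  | func f ts ih =>
    cases f with
    | exp =>
      rw [expSub_func_exp, Finset.mem_insert, Finset.mem_biUnion] at he
      rcases he with rfl | ⟨i, -, hi⟩
      · exact ⟨ts, rfl⟩
      · exact ih i hi
    | _ =>
      rw [expSub, Finset.mem_biUnion] at he
      obtain ⟨i, -, hi⟩ := he
      exact ih i hi

omit [DecidableEq α] in
/-- The **size** (number of symbols) of a term. [folklore] -/
def tsize : Language.orderedExpRing.Term α → ℕ
  | var _ => 1
  | func _ ts => (∑ i, tsize (ts i)) + 1

omit [DecidableEq α] in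
/-- Arguments are smaller than the term. [folklore] -/
theorem tsize_arg_lt {n : ℕ} (f : Language.orderedExpRing.Functions n)
    (ts : Fin n → Language.orderedExpRing.Term α) (i : Fin n) :
    tsize (ts i) < tsize (func f ts) := by
  rw [tsize]
  have := Finset.single_le_sum (fun j (_ : j ∈ (Finset.univ : Finset (Fin n))) =>
    Nat.zero_le (tsize (ts j))) (Finset.mem_univ i)
  omega

/-- Exponential subterms are at most as large as the term. [folklore] -/
theorem tsize_le_of_mem_expSub {t e : Language.orderedExpRing.Term α} (he : e ∈ expSub t) :
    tsize e ≤ tsize t := by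
  induction t with
  | var a => simp at he
  | func f ts ih =>
    cases f with
    | exp =>
      rw [expSub_func_exp, Finset.mem_insert, Finset.mem_biUnion] at he
      rcases he with rfl | ⟨i, -, hi⟩
      · exact le_rfl
      · exact (ih i hi).trans (tsize_arg_lt _ ts i).le
    | _ =>
      rw [expSub, Finset.mem_biUnion] at he
      obtain ⟨i, -, hi⟩ := he
      exact (ih i hi).trans (tsize_arg_lt _ ts i).le

/-- An exponential subterm of the *argument* of `exp(s)` is strictly smaller than `exp(s)`.
[folklore] -/
theorem tsize_lt_of_mem_expSub_arg (es : Fin 1 → Language.orderedExpRing.Term α)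
    {e : Language.orderedExpRing.Term α} (he : e ∈ expSub (es 0)) :
    tsize e < tsize (func expRingFunc.exp es) :=
  (tsize_le_of_mem_expSub he).trans_lt (tsize_arg_lt _ es 0)

/-! ### `expSub` of the term operations -/

/-- `expSub (t₁ + t₂)`. [folklore] -/
@[simp] theorem expSub_add (t₁ t₂ : Language.orderedExpRing.Term α) :
    expSub (t₁ + t₂) = expSub t₁ ∪ expSub t₂ := by
  show expSub (func expRingFunc.add ![t₁, t₂]) = _
  rw [expSub]
  simp [Fin.univ_succ]

/-- `expSub (t₁ * t₂)`. [folklore] -/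
@[simp] theorem expSub_mul (t₁ t₂ : Language.orderedExpRing.Term α) :
    expSub (t₁ * t₂) = expSub t₁ ∪ expSub t₂ := by
  show expSub (func expRingFunc.mul ![t₁, t₂]) = _
  rw [expSub]
  simp [Fin.univ_succ]

/-- `expSub (-t)`. [folklore] -/
@[simp] theorem expSub_neg (t : Language.orderedExpRing.Term α) : expSub (-t) = expSub t := by
  show expSub (func expRingFunc.neg ![t]) = _
  rw [expSub]
  simp

/-- `expSub 0 = ∅`. [folklore] -/
@[simp] theorem expSub_zero : expSub (0 : Language.orderedExpRing.Term α) = ∅ := by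
  show expSub (func expRingFunc.zero _) = _
  rw [expSub]
  simp

/-- `expSub 1 = ∅`. [folklore] -/
@[simp] theorem expSub_one : expSub (1 : Language.orderedExpRing.Term α) = ∅ := by
  show expSub (func expRingFunc.one _) = _
  rw [expSub]
  simp

/-- `expSub (exp t) = {exp t} ∪ expSub t`. [folklore] -/
@[simp] theorem expSub_termExp (t : Language.orderedExpRing.Term α) :
    expSub (Language.orderedExpRing.termExp t) =
      insert (Language.orderedExpRing.termExp t) (expSub t) := by
  show expSub (func expRingFunc.exp ![t]) = insert (func expRingFunc.exp ![t]) _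
  rw [expSub]
  simp

omit [DecidableEq α] in
/-- A one-tuple of terms is the tuple of its value. [folklore] -/
theorem vec_fin_one (ts : Fin 1 → Language.orderedExpRing.Term α) : ![ts 0] = ts := by
  funext i
  fin_cases i
  rfl

omit [DecidableEq α] in
/-- `exp(ts)` as `termExp`. [folklore] -/
theorem func_exp_eq_termExp (ts : Fin 1 → Language.orderedExpRing.Term α) :
    (func expRingFunc.exp ts : Language.orderedExpRing.Term α) =
      Language.orderedExpRing.termExp (ts 0) := by
  show func expRingFunc.exp ts = func expRingFunc.exp ![ts 0]
  rw [vec_fin_one]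

/-- `expSub` of a finite sum of terms. [folklore] -/
theorem expSub_sum_subset {m : ℕ} (t : Fin m → Language.orderedExpRing.Term α) :
    expSub (ExpTerm.sum t) ⊆ Finset.univ.biUnion fun i => expSub (t i) := by
  induction m with
  | zero => simp [ExpTerm.sum]
  | succ m ih =>
    rw [ExpTerm.sum, expSub_add]
    refine Finset.union_subset ?_ ?_
    · exact Finset.subset_biUnion_of_mem (fun i => expSub (t i)) (Finset.mem_univ 0)
    · refine (ih _).trans ?_
      simp only [Finset.biUnion_subset_iff_forall_subset]
      intro i _
      exact Finset.subset_biUnion_of_mem (fun i => expSub (t i)) (Finset.mem_univ i.succ)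

/-- `expSub` of a sign term is empty. [folklore] -/
@[simp] theorem expSub_sign (j : ℕ) : expSub (ExpTerm.sign j : Language.orderedExpRing.Term α) = ∅ := by
  unfold ExpTerm.sign
  split_ifs <;> simp

/-- `expSub` of a determinant of terms. [folklore] -/
theorem expSub_det_subset {m : ℕ} (A : Matrix (Fin m) (Fin m) (Language.orderedExpRing.Term α)) :
    expSub (ExpTerm.det A) ⊆ Finset.univ.biUnion fun ij : Fin m × Fin m => expSub (A ij.1 ij.2) := by
  induction m with
  | zero => simp [ExpTerm.det]
  | succ m ih =>
    rw [ExpTerm.det]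
    refine (expSub_sum_subset _).trans ?_
    simp only [Finset.biUnion_subset_iff_forall_subset]
    intro j _
    rw [expSub_mul, expSub_mul, expSub_sign, Finset.empty_union]
    refine Finset.union_subset ?_ ?_
    · exact Finset.subset_biUnion_of_mem (fun ij : Fin (m + 1) × Fin (m + 1) => expSub (A ij.1 ij.2))
        (Finset.mem_univ ((0 : Fin (m + 1)), j))
    · refine (ih _).trans ?_
      simp only [Finset.biUnion_subset_iff_forall_subset]
      rintro ⟨i, l⟩ -
      exact Finset.subset_biUnion_of_mem
        (fun ij : Fin (m + 1) × Fin (m + 1) => expSub (A ij.1 ij.2))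
        (Finset.mem_univ (Fin.succ i, j.succAbove l))

/-- **Formal partial derivatives create no new exponentials.** [folklore] -/
theorem expSub_termPDeriv_subset {κ ι : Type} [DecidableEq κ] [DecidableEq ι] (i : ι)
    (t : Language.orderedExpRing.Term (κ ⊕ ι)) :
    expSub (RealExpModel.termPDeriv i t) ⊆ expSub t := by
  induction t with
  | var v =>
    rcases v with c | j
    · simp [RealExpModel.termPDeriv]
    · by_cases h : j = i
      · subst h; simp
      · rw [RealExpModel.termPDeriv_var_inr_of_ne i j h]; simp
  | func f ts ih =>
    cases f with
    | add =>
      show expSub (RealExpModel.termPDeriv i (ts 0) + RealExpModel.termPDeriv i (ts 1)) ⊆ _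
      rw [expSub_add, expSub]
      refine Finset.union_subset ?_ ?_
      · exact (ih 0).trans (Finset.subset_biUnion_of_mem (fun i => expSub (ts i)) (Finset.mem_univ 0))
      · exact (ih 1).trans (Finset.subset_biUnion_of_mem (fun i => expSub (ts i)) (Finset.mem_univ 1))
    | mul =>
      show expSub (RealExpModel.termPDeriv i (ts 0) * ts 1 + ts 0 * RealExpModel.termPDeriv i (ts 1)) ⊆ _
      rw [expSub_add, expSub_mul, expSub_mul, expSub]
      have h0 := Finset.subset_biUnion_of_mem (fun i => expSub (ts i)) (Finset.mem_univ (0 : Fin 2))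
      have h1 := Finset.subset_biUnion_of_mem (fun i => expSub (ts i)) (Finset.mem_univ (1 : Fin 2))
      exact Finset.union_subset (Finset.union_subset ((ih 0).trans h0) h1)
        (Finset.union_subset h0 ((ih 1).trans h1))
    | neg =>
      show expSub (-RealExpModel.termPDeriv i (ts 0)) ⊆ _
      rw [expSub_neg, expSub]
      exact (ih 0).trans (Finset.subset_biUnion_of_mem (fun i => expSub (ts i)) (Finset.mem_univ 0))
    | zero =>
      show expSub (0 : Language.orderedExpRing.Term (κ ⊕ ι)) ⊆ _
      simp
    | one =>
      show expSub (0 : Language.orderedExpRing.Term (κ ⊕ ι)) ⊆ _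
      simp
    | exp =>
      show expSub (Language.orderedExpRing.termExp (ts 0) * RealExpModel.termPDeriv i (ts 0)) ⊆ _
      rw [expSub_mul, expSub_termExp, ← func_exp_eq_termExp, expSub_func_exp]
      refine Finset.union_subset ?_ ?_
      · exact Finset.insert_subset_insert _
          (Finset.subset_biUnion_of_mem (fun i => expSub (ts i)) (Finset.mem_univ 0))
      · exact (ih 0).trans ((Finset.subset_biUnion_of_mem (fun i => expSub (ts i))
          (Finset.mem_univ 0)).trans (Finset.subset_insert _ _))

end ExpSub

/-! ### Relabelling -/

section Relabel

variable [DecidableEq α] [DecidableEq β]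

/-- `expSub` commutes with relabelling of variables. [folklore] -/
theorem expSub_relabel (g : α → β) (t : Language.orderedExpRing.Term α) :
    expSub (t.relabel g) = (expSub t).image (Term.relabel g) := by
  induction t with
  | var a => simp [Term.relabel]
  | func f ts ih =>
    cases f with
    | exp =>
      show insert (func expRingFunc.exp fun i => (ts i).relabel g)
          (Finset.univ.biUnion fun i => expSub ((ts i).relabel g)) =
        (insert (func expRingFunc.exp ts) (Finset.univ.biUnion fun i => expSub (ts i))).image
          (Term.relabel g)
      rw [Finset.image_insert, Finset.biUnion_image]
      congr 1
      exact Finset.biUnion_congr rfl fun i _ => ih i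
    | _ =>
      show (Finset.univ.biUnion fun i => expSub ((ts i).relabel g)) =
        (Finset.univ.biUnion fun i => expSub (ts i)).image (Term.relabel g)
      rw [Finset.biUnion_image]
      exact Finset.biUnion_congr rfl fun i _ => ih i

/-- Relabelling does not increase the number of exponential subterms. [folklore] -/
theorem card_expSub_relabel_le (g : α → β) (t : Language.orderedExpRing.Term α) :
    (expSub (t.relabel g)).card ≤ (expSub t).card := by
  rw [expSub_relabel]
  exact Finset.card_image_le

end Relabel

/-! ### Substitution of a subterm -/

section Subst

variable [DecidableEq α]

/-- **Substitution of a subterm**: replace every occurrence of the subterm `e` in `t` by the term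
`y` (in new variables `β`), relabelling all other variables along `ι : α → β`. [folklore] -/
def substExp (e : Language.orderedExpRing.Term α) (y : Language.orderedExpRing.Term β) (ι : α → β) :
    Language.orderedExpRing.Term α → Language.orderedExpRing.Term β
  | var a => if (var a : Language.orderedExpRing.Term α) = e then y else var (ι a)
  | func f ts => if func f ts = e then y else func f fun i => substExp e y ι (ts i)

/-- Substituting into `e` itself gives `y`. [folklore] -/
theorem substExp_self (e : Language.orderedExpRing.Term α) (y : Language.orderedExpRing.Term β)
    (ι : α → β) : substExp e y ι e = y := by
  cases e with
  | var a => simp [substExp]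
  | func f ts => simp [substExp]

/-- **The value is unchanged** when `y` takes the value of `e`: for valuations `v` on `α` and `V`
on `β` with `V ∘ ι = v` and `y(V) = e(v)`, `(substExp e y ι t)(V) = t(v)`. [folklore] -/
theorem realize_substExp {M : Type*} [Language.orderedExpRing.Structure M]
    (e : Language.orderedExpRing.Term α) (y : Language.orderedExpRing.Term β) (ι : α → β)
    (v : α → M) (V : β → M) (hV : ∀ a, V (ι a) = v a) (hy : y.realize V = e.realize v)
    (t : Language.orderedExpRing.Term α) : (substExp e y ι t).realize V = t.realize v := by
  induction t with
  | var a =>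
    unfold substExp
    split_ifs with h
    · rw [hy, ← h]
    · simp [hV]
  | func f ts ih =>
    unfold substExp
    split_ifs with h
    · rw [hy, ← h]
    · simp only [Term.realize_func]
      congr 1
      funext i
      exact ih i

/-- A term in which `e` (an `exp`-term) has no occurrence is merely relabelled. [folklore] -/
theorem substExp_eq_relabel_of_not_mem (es : Fin 1 → Language.orderedExpRing.Term α)
    (y : Language.orderedExpRing.Term β) (ι : α → β) {t : Language.orderedExpRing.Term α}
    (ht : func expRingFunc.exp es ∉ expSub t) :
    substExp (func expRingFunc.exp es) y ι t = t.relabel ι := by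
  induction t with
  | var a => simp [substExp, Term.relabel]
  | func f ts ih =>
    unfold substExp
    split_ifs with h
    · rw [h] at ht
      exact (ht (by rw [expSub_func_exp]; exact Finset.mem_insert_self _ _)).elim
    · rw [Term.relabel]
      congr 1
      funext i
      exact ih i fun hi => ht (expSub_arg_subset f ts i hi)

variable [DecidableEq β]

/-- **Eliminating an exponential of maximal size.** If `e = exp(s)` is at least as large as every
exponential subterm of `t` and `y` has no exponential subterms, then the exponential subterms of
`substExp e y ι t` are relabellings of exponential subterms of `t` other than `e`. [folklore] -/
theorem expSub_substExp_subset (es : Fin 1 → Language.orderedExpRing.Term α)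
    (y : Language.orderedExpRing.Term β) (hy : expSub y = ∅) (ι : α → β)
    {t : Language.orderedExpRing.Term α}
    (hmax : ∀ e' ∈ expSub t, tsize e' ≤ tsize (func expRingFunc.exp es)) :
    expSub (substExp (func expRingFunc.exp es) y ι t) ⊆
      ((expSub t).erase (func expRingFunc.exp es)).image (Term.relabel ι) := by
  induction t with
  | var a => simp [substExp]
  | func f ts ih =>
    have hmaxi : ∀ i, ∀ e' ∈ expSub (ts i), tsize e' ≤ tsize (func expRingFunc.exp es) :=
      fun i e' he' => hmax e' (expSub_arg_subset f ts i he')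
    have hsub : ∀ i, ((expSub (ts i)).erase (func expRingFunc.exp es)).image (Term.relabel ι) ⊆
        ((expSub (func f ts)).erase (func expRingFunc.exp es)).image (Term.relabel ι) :=
      fun i => Finset.image_subset_image (Finset.erase_subset_erase _ (expSub_arg_subset f ts i))
    unfold substExp
    split_ifs with h
    · rw [hy]; exact Finset.empty_subset _
    · cases f with
      | exp =>
        -- `e` does not occur in the argument of this (other) exponential, by maximality
        have hnot : func expRingFunc.exp es ∉ expSub (ts 0) := fun hmem =>
          (tsize_lt_of_mem_expSub_arg ts hmem).not_ge
            (hmax _ (by rw [expSub_func_exp]; exact Finset.mem_insert_self _ _))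
        have harg : ∀ i, substExp (func expRingFunc.exp es) y ι (ts i) = (ts i).relabel ι := by
          intro i
          have hi : i = 0 := Subsingleton.elim i 0
          subst hi
          exact substExp_eq_relabel_of_not_mem es y ι hnot
        have hfun : (func expRingFunc.exp fun i => substExp (func expRingFunc.exp es) y ι (ts i) :
            Language.orderedExpRing.Term β) = (func expRingFunc.exp ts).relabel ι := by
          rw [Term.relabel]
          congr 1
          funext i
          exact harg i
        rw [hfun, expSub_relabel]
        refine Finset.image_subset_image ?_
        intro x hx
        rw [Finset.mem_erase]
        refine ⟨fun hxe => ?_, hx⟩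
        rw [hxe, expSub_func_exp, Finset.mem_insert, Finset.mem_biUnion] at hx
        rcases hx with hx | ⟨i, -, hi⟩
        · exact h hx.symm
        · have hi0 : i = 0 := Subsingleton.elim i 0
          subst hi0
          exact hnot hi
      | _ =>
        rw [expSub]
        simp only [Finset.biUnion_subset_iff_forall_subset]
        intro i _
        exact (ih i (hmaxi i)).trans (hsub i)

/-- Hence the number of exponential subterms drops by at least one when an exponential subterm of
maximal size is eliminated. [folklore] -/
theorem card_expSub_substExp_lt (es : Fin 1 → Language.orderedExpRing.Term α)
    (y : Language.orderedExpRing.Term β) (hy : expSub y = ∅) (ι : α → β)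
    {t : Language.orderedExpRing.Term α} (hmem : func expRingFunc.exp es ∈ expSub t)
    (hmax : ∀ e' ∈ expSub t, tsize e' ≤ tsize (func expRingFunc.exp es)) :
    (expSub (substExp (func expRingFunc.exp es) y ι t)).card < (expSub t).card := by
  calc (expSub (substExp (func expRingFunc.exp es) y ι t)).card
      ≤ (((expSub t).erase (func expRingFunc.exp es)).image (Term.relabel ι)).card :=
        Finset.card_le_card (expSub_substExp_subset es y hy ι hmax)
    _ ≤ ((expSub t).erase (func expRingFunc.exp es)).card := Finset.card_image_le
    _ < (expSub t).card := Finset.card_erase_lt_of_mem hmem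

end Subst

/-! ### Terms without exponentials are polynomials -/

section Poly

/-- The polynomial (integer coefficients) of a term, reading `exp` as `0` (meaningful for terms
without exponential subterms, `realize_eq_aeval_toPoly`). [folklore] -/
def toPoly : Language.orderedExpRing.Term α → MvPolynomial α ℤ
  | var a => MvPolynomial.X a
  | func expRingFunc.add ts => toPoly (ts 0) + toPoly (ts 1)
  | func expRingFunc.mul ts => toPoly (ts 0) * toPoly (ts 1)
  | func expRingFunc.neg ts => -toPoly (ts 0)
  | func expRingFunc.zero _ => 0
  | func expRingFunc.one _ => 1
  | func expRingFunc.exp _ => 0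

/-- **A term without exponential subterms realizes, in `ℝ`, to the evaluation of its polynomial.**
[folklore] -/
theorem realize_eq_aeval_toPoly [DecidableEq α] (t : Language.orderedExpRing.Term α)
    (ht : expSub t = ∅) (v : α → ℝ) : t.realize v = MvPolynomial.aeval v (toPoly t) := by
  induction t with
  | var a => simp [toPoly]
  | func f ts ih =>
    cases f with
    | add =>
      have h0 := ih 0 (Finset.subset_empty.1 ((expSub_arg_subset _ ts 0).trans ht.subset))
      have h1 := ih 1 (Finset.subset_empty.1 ((expSub_arg_subset _ ts 1).trans ht.subset))
      simp only [toPoly, map_add, ← h0, ← h1, Term.realize]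
      rfl
    | mul =>
      have h0 := ih 0 (Finset.subset_empty.1 ((expSub_arg_subset _ ts 0).trans ht.subset))
      have h1 := ih 1 (Finset.subset_empty.1 ((expSub_arg_subset _ ts 1).trans ht.subset))
      simp only [toPoly, map_mul, ← h0, ← h1, Term.realize]
      rfl
    | neg =>
      have h0 := ih 0 (Finset.subset_empty.1 ((expSub_arg_subset _ ts 0).trans ht.subset))
      simp only [toPoly, map_neg, ← h0, Term.realize]
      rfl
    | zero =>
      simp only [toPoly, map_zero, Term.realize]
      rfl
    | one =>
      simp only [toPoly, map_one, Term.realize]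
      rfl
    | exp =>
      rw [expSub_func_exp] at ht
      exact absurd ht (Finset.insert_ne_empty _ _)

end Poly

end ExpTerm

end Literature.ModelTheory.ExponentialFields
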